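import Literature.Geometry.Lorentzian.SpacetimeLocalConvergenceTransIndex
import HarnessLib

/-!
# Limits of limits: the diagonal datum for pointed `Cᵏ_loc` convergence of spacetimes
(topic `Geometry/Lorentzian`; `Spacetime.LocalSubconvergence.trans` and
`Spacetime.SubconvergesLocallyTo.trans` — the "diagonal lemma for `LocalSubconvergence`" requested
by the hull-based lines of the Final State Conjecture routes: own hulls / generator hulls are closed
under taking limits, Hale 1980, Ch. I §8, Thm. 8.1; Petersen 2006, Ch. 10, §3.2)

**Theorem (`LocalSubconvergence.trans`).** Let `D₁` be a pointed `Cᵏ_loc` subconvergence datum of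
the pointed spacetimes `(𝓢ₙ, pₙ)` to `(𝓣, t)` (comparison maps `φₙ : 𝓣 → 𝓢_{sub n}`), and let `D₂`
be a subconvergence datum of the TRANSLATES `(𝓣, q'ₘ)` of the middle spacetime to `(𝓤, u)`
(comparison maps `Fₘ : 𝓤 → 𝓣`). Then along explicit strictly increasing index maps
`level, index : ℕ → ℕ` the diagonal sequence `m ↦ (𝓢_{sub (index m)}, φ_{index m}(F_{level (m+1)}(u)))`
converges to `(𝓤, u)` in the pointed `Cᵏ_loc` sense, with comparison maps the composites
`φ_{index m} ∘ F_{level (m+1)}` and exhaustion `m ↦ U₂ (level m)`.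

Construction (all quantitative inputs are the preceding files of this series):
* `level` (`exists_level`): sparsify the exhaustion of `D₂` so that
  `closure (U₂ (level m)) ⊆ U₂ (level (m+1))` and `dF_{level (m+1)}` sends the orienting field of `𝓤`
  to TIMELIKE vectors on `closure (U₂ (level m))` (`eventually_isTimelike_mfderiv_embed`).
* reference balls (`exists_refData`): finitely many compact chart balls of `𝓤` per level, inside
  `U₂ (level (m+1))`, whose open cores cover `closure (U₂ (level m))` (`exists_finset_chartBalls`).
* `index` (`exists_index`): at stage `m` choose `n` so large that (i) `F(closure U₂(level m)) ⊆ U₁ n`,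
  (ii) `d(φₙ ∘ F)` preserves the time orientation on `closure (U₂ (level m))`
  (`eventually_isFutureDirected_mfderiv_comp`), (iii) the FIRST BRACKET
  `(φₙ ∘ F ∘ c_p⁻¹)^* gₙ − (F ∘ c_p⁻¹)^* g_𝓣` has `Cᵏ` sup norm `≤ 1/(m+1)` on every reference ball of
  level `≤ m` (`tendsto_supCkENorm_comp_sub`).
* convergence (`tendsto_supCkENorm_trans`): on a reference ball the deviation of the composite is
  first bracket + deviation of `F_{level (m+1)}` (→ `0` + `0`); the transfer theorem
  `tendsto_supCkENorm_chartDeviation_of_reference` upgrades this to every compact chart piece.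

## References
* [Petersen2006] P. Petersen, *Riemannian Geometry*, 2nd ed., GTM 171, Springer 2006, Ch. 10, §3.2.
* [Hale1980] J. K. Hale, *Ordinary Differential Equations*, 2nd ed., Krieger 1980, Ch. I §8,
  Thm. 8.1 (limit sets are closed and invariant).
-/

noncomputable section

open TopologicalSpace Manifold Filter Topology Set Function Metric Bundle
open scoped ContDiff Topology ENNReal

universe u v w

namespace Literature.Geometry.Lorentzian

namespace Spacetime

namespace LocalSubconvergence

variable {𝓢ₙ : ℕ → Spacetime.{u} 4} {pₙ : ∀ n, (𝓢ₙ n).carrier} {𝓣 : Spacetime.{v} 4}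
  {t : 𝓣.carrier} {k : ℕ} {𝓤 : Spacetime.{w} 4} {q' : ℕ → 𝓣.carrier} {u : 𝓤.carrier}

/-! ### Step D: the diagonal datum -/

section Datum

variable (D₁ : LocalSubconvergence 𝓢ₙ pₙ 𝓣 t k) (D₂ : LocalSubconvergence (fun _ ↦ 𝓣) q' 𝓤 u k)

/-- The **composite comparison maps** `φ_{index m} ∘ F_{level (m+1)} : 𝓤 → 𝓢_{sub (index m)}`. [cite: Petersen2006, Ch. 10 §3.2] -/
def transEmbed (m : ℕ) : 𝓤.carrier → (𝓢ₙ (D₁.sub (index D₁ D₂ m))).carrier :=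
  D₁.embed (index D₁ D₂ m) ∘ D₂.stageMap m

/-- The **base points of the diagonal sequence**: `Qₘ = φ_{index m}(F_{level (m+1)}(u))`. [cite: Petersen2006, Ch. 10 §3.2] -/
def transBasepoint (m : ℕ) : (𝓢ₙ (D₁.sub (index D₁ D₂ m))).carrier := transEmbed D₁ D₂ m u

/-- The base points, explicitly. [folklore] -/
theorem transBasepoint_eq (m : ℕ) : transBasepoint D₁ D₂ m =
    D₁.embed (index D₁ D₂ m) (D₂.embed (D₂.level (m + 1)) u) := rfl

/-- The middle point of the `m`-th base point is a base point of the second datum: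
`F_{level (m+1)}(u) = q'_{sub₂ (level (m+1))}`. [folklore] -/
theorem stageMap_basepoint (m : ℕ) : D₂.stageMap m u = q' (D₂.sub (D₂.level (m + 1))) :=
  D₂.embed_basepoint _

/-- The composite is `C^∞` on `U (level m)`. [folklore] -/
theorem contMDiffOn_transEmbed (m : ℕ) :
    ContMDiffOn (𝓡 4) (𝓡 4) ∞ (transEmbed D₁ D₂ m) (D₂.U (D₂.level m)) := by
  refine (D₁.contMDiffOn_embed _).comp ((D₂.contMDiffOn_stageMap m).mono
    (D₂.U_level_subset_succ m)) fun x hx ↦ ?_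
  exact (indexGood_index D₁ D₂ m).1 (mem_image_of_mem _ (subset_closure hx))

/-- The composite is a local diffeomorphism on `U (level m)`. [folklore] -/
theorem isLocalDiffeomorphOn_transEmbed (m : ℕ) :
    IsLocalDiffeomorphOn (𝓡 4) (𝓡 4) ∞ (transEmbed D₁ D₂ m) (D₂.U (D₂.level m)) := by
  refine isLocalDiffeomorphOn_comp (D₁.isLocalDiffeomorphOn_embed _)
    (fun x ↦ D₂.isLocalDiffeomorphOn_embed _ ⟨x.1, D₂.U_level_subset_succ m x.2⟩) fun x hx ↦ ?_
  exact (indexGood_index D₁ D₂ m).1 (mem_image_of_mem _ (subset_closure hx))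

/-- The composite is injective on `U (level m)`. [folklore] -/
theorem injOn_transEmbed (m : ℕ) : InjOn (transEmbed D₁ D₂ m) (D₂.U (D₂.level m)) :=
  (D₁.injOn_embed _).comp ((D₂.injOn_embed _).mono (D₂.U_level_subset_succ m)) fun _ hx ↦
    (indexGood_index D₁ D₂ m).1 (mem_image_of_mem _ (subset_closure hx))

/-- The composite preserves the time orientation on `U (level m)`. [folklore] -/
theorem isFutureDirected_mfderiv_transEmbed (m : ℕ) {x : 𝓤.carrier}
    (hx : x ∈ D₂.U (D₂.level m)) :
    (𝓢ₙ (D₁.sub (index D₁ D₂ m))).timeOrientation.IsFutureDirected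
      (mfderiv (𝓡 4) (𝓡 4) (transEmbed D₁ D₂ m) x (𝓤.timeOrientation.vectorField x)) :=
  (indexGood_index D₁ D₂ m).2.1 x (subset_closure hx)

/-- **Decomposition of the deviation of the composite on a reference ball**:
deviation of `φ ∘ F` from `𝓤` = first bracket + deviation of `F` from `𝓤`. [folklore] -/
theorem chartDeviation_transEmbed_eq (m : ℕ) (p : 𝓤.carrier) :
    chartDeviation (𝓢ₙ (D₁.sub (index D₁ D₂ m))) (transEmbed D₁ D₂ m) p =
      firstBracket D₁ D₂ (index D₁ D₂ m) m p + D₂.coordDeviation (D₂.level (m + 1)) p := by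
  funext y
  simp only [chartDeviation, firstBracket, coordDeviation, transEmbed, stageMap, Pi.add_apply,
    Pi.sub_apply]
  abel

/-- **Convergence on the reference balls**: for a reference point `p` of level `m₀` the `Cᵏ` sup
norm over its reference ball of the deviation of the composite tends to `0`
(`≤ 1/(m+1) +` the deviation of `F_{level (m+1)}`, for `m ≥ m₀ + 1`). [cite: Petersen2006, Ch. 10 §3.2] -/
theorem tendsto_supCkENorm_refBall {m₀ : ℕ} {p : 𝓤.carrier} (hp : p ∈ D₂.refPoints m₀) :
    Tendsto (fun m ↦ supCkENorm (D₂.refBall m₀ p) k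
      (chartDeviation (𝓢ₙ (D₁.sub (index D₁ D₂ m))) (transEmbed D₁ D₂ m) p)) atTop (𝓝 0) := by
  obtain ⟨-, hBt, hBU⟩ := D₂.refBall_spec hp
  set c := chartAt E4 p with hc
  -- the upper bound, eventually
  have hupper : ∀ᶠ m in atTop, supCkENorm (D₂.refBall m₀ p) k
      (chartDeviation (𝓢ₙ (D₁.sub (index D₁ D₂ m))) (transEmbed D₁ D₂ m) p) ≤
      ((m + 1 : ℕ) : ℝ≥0∞)⁻¹ + supCkENorm (D₂.refBall m₀ p) k
        (D₂.coordDeviation (D₂.level (m + 1)) p) := by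
    filter_upwards [eventually_ge_atTop (m₀ + 1)] with m hm
    rw [chartDeviation_transEmbed_eq]
    -- smoothness of both summands near the ball
    set V₀ : Set E4 := c.target ∩ c.symm ⁻¹' (D₂.U (D₂.level (m₀ + 1)) : Set 𝓤.carrier) with hV₀
    have hV₀o : IsOpen V₀ := c.continuousOn_symm.isOpen_inter_preimage c.open_target (D₂.U _).isOpen
    have hBV₀ : D₂.refBall m₀ p ⊆ V₀ := fun y hy ↦ ⟨hBt hy, hBU (mem_image_of_mem _ hy)⟩
    have hEs : ContMDiffOn (𝓡 4) (𝓡 4) ∞ (transEmbed D₁ D₂ m) (D₂.U (D₂.level (m₀ + 1))) :=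
      (contMDiffOn_transEmbed D₁ D₂ m).mono (D₂.U_level_mono hm)
    have hFs : ContMDiffOn (𝓡 4) (𝓡 4) ∞ (D₂.stageMap m) (D₂.U (D₂.level (m₀ + 1))) :=
      (D₂.contMDiffOn_stageMap m).mono (D₂.U_level_mono (hm.trans (Nat.le_succ m)))
    have hfb : ContDiffOn ℝ ∞ (firstBracket D₁ D₂ (index D₁ D₂ m) m p) V₀ :=
      ((𝓤.contDiffOn_metricInCoords_comp_chartAt_symm p (D₂.U _).isOpen hEs).sub
        (𝓤.contDiffOn_metricInCoords_comp_chartAt_symm p (D₂.U _).isOpen hFs))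
    have hcd : ContDiffOn ℝ ∞ (D₂.coordDeviation (D₂.level (m + 1)) p)
        (c.target ∩ c.symm ⁻¹' (D₂.U (D₂.level (m + 1)) : Set 𝓤.carrier)) := by
      rw [D₂.coordDeviation_eq_chartDeviation]
      exact contDiffOn_chartDeviation _ (D₂.U _).isOpen (D₂.contMDiffOn_embed _) p
    have hfbAt : ∀ y ∈ D₂.refBall m₀ p,
        ContDiffAt ℝ k (firstBracket D₁ D₂ (index D₁ D₂ m) m p) y := fun y hy ↦
      ((hfb.of_le (by exact_mod_cast le_top)).contDiffAt (hV₀o.mem_nhds (hBV₀ hy)))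
    have hcdAt : ∀ y ∈ D₂.refBall m₀ p,
        ContDiffAt ℝ k (D₂.coordDeviation (D₂.level (m + 1)) p) y := fun y hy ↦
      (hcd.of_le (by exact_mod_cast le_top)).contDiffAt
        ((c.continuousOn_symm.isOpen_inter_preimage c.open_target (D₂.U _).isOpen).mem_nhds
          ⟨hBt hy, D₂.U_level_mono (hm.trans (Nat.le_succ m)) (hBU (mem_image_of_mem _ hy))⟩)
    refine (supCkENorm_add_le hfbAt hcdAt).trans (add_le_add ?_ le_rfl)
    exact (indexGood_index D₁ D₂ m).2.2 m₀ (Finset.mem_range.2 (by omega)) p hp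
  -- both bounds tend to zero
  have hlim1 : Tendsto (fun m : ℕ ↦ ((m + 1 : ℕ) : ℝ≥0∞)⁻¹) atTop (𝓝 0) :=
    ENNReal.tendsto_inv_nat_nhds_zero.comp (tendsto_add_atTop_nat 1)
  have hlim2 : Tendsto (fun m ↦ supCkENorm (D₂.refBall m₀ p) k
      (D₂.coordDeviation (D₂.level (m + 1)) p)) atTop (𝓝 0) :=
    (D₂.tendsto_supCkENorm_coordDeviation p (D₂.isCompact_refBall m₀ p) hBt).comp
      (D₂.strictMono_level.tendsto_atTop.comp (tendsto_add_atTop_nat 1))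
  have hsum := hlim1.add hlim2
  rw [add_zero] at hsum
  exact tendsto_of_tendsto_of_tendsto_of_le_of_le' tendsto_const_nhds hsum
    (Eventually.of_forall fun _ ↦ zero_le) hupper

/-- **Convergence of the diagonal datum** in every preferred chart of the limit, on every compact
chart piece (transfer from the reference balls). [cite: Petersen2006, Ch. 10 §3.2] -/
theorem tendsto_supCkENorm_trans (x : 𝓤.carrier) {K : Set E4} (hK : IsCompact K)
    (hKt : K ⊆ (chartAt E4 x).target) :
    Tendsto (fun m ↦ supCkENorm K k
      (chartDeviation (𝓢ₙ (D₁.sub (index D₁ D₂ m))) (transEmbed D₁ D₂ m) x)) atTop (𝓝 0) := by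
  -- the reference family
  let J := (m : ℕ) × (D₂.refPoints m : Set 𝓤.carrier)
  refine tendsto_supCkENorm_chartDeviation_of_reference
    (𝓢 := fun m ↦ 𝓢ₙ (D₁.sub (index D₁ D₂ m))) (E := fun m ↦ transEmbed D₁ D₂ m) ?_
    (J := J) (fun j ↦ (j.2 : 𝓤.carrier))
    (fun j ↦ ball (chartAt E4 (j.2 : 𝓤.carrier) j.2) (D₂.refRadius j.1 j.2))
    (fun j ↦ D₂.refBall j.1 j.2) (fun _ ↦ isOpen_ball) (fun _ ↦ ball_subset_closedBall)
    (fun j ↦ D₂.isCompact_refBall j.1 j.2) (fun j ↦ (D₂.refBall_spec j.2.2).2.1) ?_ ?_ x hK hKt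
  · -- smoothness on compacts, eventually
    intro C hC
    have hev : ∀ᶠ m in atTop, C ⊆ D₂.U (D₂.level m) :=
      D₂.strictMono_level.tendsto_atTop.eventually (D₂.eventually_subset_U hC)
    filter_upwards [hev] with m hm
    exact ⟨D₂.U (D₂.level m), (D₂.U _).isOpen, hm, contMDiffOn_transEmbed D₁ D₂ m⟩
  · -- the cores cover
    intro q
    have hq : q ∈ ⋃ n, (D₂.U n : Set 𝓤.carrier) := D₂.iUnion_U.symm ▸ mem_univ q
    obtain ⟨n, hn⟩ := mem_iUnion.1 hq
    have hqn : q ∈ closure (D₂.U (D₂.level n) : Set 𝓤.carrier) :=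
      subset_closure (D₂.monotone_U (D₂.strictMono_level.id_le n) hn)
    obtain ⟨p, hp, hqp⟩ := mem_iUnion₂.1 (D₂.closure_U_level_subset_refCover n hqn)
    exact ⟨⟨n, ⟨p, hp⟩⟩, hqp.1, hqp.2⟩
  · -- convergence on the reference balls
    intro j
    exact tendsto_supCkENorm_refBall D₁ D₂ j.2.2

/-- **The diagonal datum ("limits of limits are limits").** From a pointed `Cᵏ_loc` subconvergence
datum `D₁ : (𝓢ₙ, pₙ) ⇀ (𝓣, t)` and a subconvergence datum `D₂ : (𝓣, q'ₘ) ⇀ (𝓤, u)` of translates of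
the middle spacetime, the diagonal sequence `m ↦ (𝓢_{sub₁ (index m)}, φ_{index m}(F_{level (m+1)} u))`
subconverges to `(𝓤, u)`: exhaustion `U₂ ∘ level`, comparison maps the composites
`φ_{index m} ∘ F_{level (m+1)}` (local diffeomorphisms, injective and orientation-preserving on
`U₂ (level m)` by the choice of `index`), and `Cᵏ` convergence of the pulled-back metrics by
`tendsto_supCkENorm_trans`. Petersen 2006, Ch. 10, §3.2; the closure/invariance of limit sets,
Hale 1980, Ch. I §8, Thm. 8.1. [cite: Petersen2006, Ch. 10 §3.2] -/
def trans : LocalSubconvergence (fun m ↦ 𝓢ₙ (D₁.sub (index D₁ D₂ m))) (transBasepoint D₁ D₂)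
    𝓤 u k where
  sub := id
  strictMono_sub := strictMono_id
  U := fun m ↦ D₂.U (D₂.level m)
  monotone_U := fun _ _ h ↦ D₂.U_level_mono h
  mem_U := D₂.basepoint_mem_U _
  iUnion_U := by
    refine eq_univ_of_forall fun x ↦ ?_
    have hx : x ∈ ⋃ n, (D₂.U n : Set 𝓤.carrier) := D₂.iUnion_U.symm ▸ mem_univ x
    obtain ⟨n, hn⟩ := mem_iUnion.1 hx
    exact mem_iUnion.2 ⟨n, D₂.monotone_U (D₂.strictMono_level.id_le n) hn⟩
  isCompact_closure_U := fun m ↦ D₂.isCompact_closure_U _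
  embed := transEmbed D₁ D₂
  isLocalDiffeomorphOn_embed := isLocalDiffeomorphOn_transEmbed D₁ D₂
  injOn_embed := injOn_transEmbed D₁ D₂
  embed_basepoint := fun _ ↦ rfl
  isFutureDirected_mfderiv_embed := fun m _ hx ↦ isFutureDirected_mfderiv_transEmbed D₁ D₂ m hx
  tendsto_supCkENorm := fun x K hK hKt ↦ tendsto_supCkENorm_trans D₁ D₂ x hK hKt

end Datum

/-! ### Re-basing a limit at another point of the limit -/

section Rebase

variable (D : LocalSubconvergence 𝓢ₙ pₙ 𝓤 u k) (x : 𝓤.carrier)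

/-- Every point of the limit lies in some exhausting set. [folklore] -/
theorem exists_mem_U : ∃ m₀, x ∈ D.U m₀ := by
  have hx : x ∈ ⋃ n, (D.U n : Set 𝓤.carrier) := D.iUnion_U.symm ▸ mem_univ x
  exact mem_iUnion.1 hx

/-- The index shift after which `x` lies in all exhausting sets. [folklore] -/
def rebaseShift : ℕ := Classical.choose (D.exists_mem_U x)

/-- `x ∈ U (m + rebaseShift)`. [folklore] -/
theorem mem_U_add_rebaseShift (m : ℕ) : x ∈ D.U (m + D.rebaseShift x) :=
  D.monotone_U (Nat.le_add_left _ _) (Classical.choose_spec (D.exists_mem_U x))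

/-- The **re-based base points**: the images `φ_{m + shift}(x)` of the new base point. [folklore] -/
def rebaseBasepoint (m : ℕ) : (𝓢ₙ (D.sub (m + D.rebaseShift x))).carrier :=
  D.embed (m + D.rebaseShift x) x

/-- **Re-basing a limit.** If `(𝓢ₙ, pₙ)` subconverge to `(𝓤, u)`, then for every point `x` of
the limit the shifted sequence `(𝓢_{sub (m+shift)}, φ_{m+shift}(x))` subconverges to `(𝓤, x)` —
same comparison maps and exhaustion, shifted so that `x` lies in every exhausting set (the limit
does not depend on where in it the sequence is based; for translates of one spacetime this is the
invariance of limit sets, Hale 1980, Ch. I §8). [cite: Hale1980, Ch. I §8 Thm. 8.1] -/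
def rebase : LocalSubconvergence (fun m ↦ 𝓢ₙ (D.sub (m + D.rebaseShift x))) (D.rebaseBasepoint x)
    𝓤 x k where
  sub := id
  strictMono_sub := strictMono_id
  U := fun m ↦ D.U (m + D.rebaseShift x)
  monotone_U := fun _ _ h ↦ D.monotone_U (Nat.add_le_add_right h _)
  mem_U := D.mem_U_add_rebaseShift x 0
  iUnion_U := by
    refine eq_univ_of_forall fun y ↦ ?_
    have hy : y ∈ ⋃ n, (D.U n : Set 𝓤.carrier) := D.iUnion_U.symm ▸ mem_univ y
    obtain ⟨n, hn⟩ := mem_iUnion.1 hy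
    exact mem_iUnion.2 ⟨n, D.monotone_U (Nat.le_add_right _ _) hn⟩
  isCompact_closure_U := fun m ↦ D.isCompact_closure_U _
  embed := fun m ↦ D.embed (m + D.rebaseShift x)
  isLocalDiffeomorphOn_embed := fun m ↦ D.isLocalDiffeomorphOn_embed _
  injOn_embed := fun m ↦ D.injOn_embed _
  embed_basepoint := fun _ ↦ rfl
  isFutureDirected_mfderiv_embed := fun m ↦ D.isFutureDirected_mfderiv_embed _
  tendsto_supCkENorm := fun x' K hK hKt ↦
    (D.tendsto_supCkENorm x' K hK hKt).comp (tendsto_add_atTop_nat (D.rebaseShift x))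

/-- The subsequence of the re-based datum is a shift of the original one. [folklore] -/
theorem strictMono_sub_add_rebaseShift : StrictMono fun m ↦ D.sub (m + D.rebaseShift x) :=
  D.strictMono_sub.comp (strictMono_id.add_const _)

end Rebase

end LocalSubconvergence

/-! ### The `Prop`-level statements -/

section PropLevel

variable {𝓢 : Spacetime.{u} 4} {𝓣 : Spacetime.{v} 4} {𝓤 : Spacetime.{w} 4} {k : ℕ}

/-- **Limits of translates of a limit are limits** (constant sequences, the form used by hull and
limit-set arguments): if the translates `(𝓢, qₙ)` subconverge to `(𝓣, t)` and the translates
`(𝓣, q'ₘ)` subconverge to `(𝓤, u)` in the pointed `Cᵏ_loc` sense, then some translates `(𝓢, Qₘ)`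
subconverge to `(𝓤, u)`; the base points `Qₘ` are images of base points `q'_{j}` of the second
sequence under comparison maps of the first convergence (`LocalSubconvergence.transBasepoint_eq`,
`LocalSubconvergence.stageMap_basepoint`). Hale 1980, Ch. I §8, Thm. 8.1 (limit sets are closed);
Petersen 2006, Ch. 10, §3.2. [cite: Hale1980, Ch. I §8 Thm. 8.1] -/
theorem SubconvergesLocallyTo.trans {q : ℕ → 𝓢.carrier} {t : 𝓣.carrier} {q' : ℕ → 𝓣.carrier}
    {u : 𝓤.carrier} (h₁ : SubconvergesLocallyTo (fun _ ↦ 𝓢) q 𝓣 t k)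
    (h₂ : SubconvergesLocallyTo (fun _ ↦ 𝓣) q' 𝓤 u k) :
    ∃ Q : ℕ → 𝓢.carrier, SubconvergesLocallyTo (fun _ ↦ 𝓢) Q 𝓤 u k ∧
      ∃ (D₁ : LocalSubconvergence (fun _ ↦ 𝓢) q 𝓣 t k)
        (D₂ : LocalSubconvergence (fun _ ↦ 𝓣) q' 𝓤 u k),
        ∀ m, Q m = D₁.embed (LocalSubconvergence.index D₁ D₂ m)
          (q' (D₂.sub (D₂.level (m + 1)))) := by
  obtain ⟨D₁⟩ := h₁
  obtain ⟨D₂⟩ := h₂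
  refine ⟨LocalSubconvergence.transBasepoint D₁ D₂, ⟨LocalSubconvergence.trans D₁ D₂⟩, D₁, D₂,
    fun m ↦ ?_⟩
  rw [LocalSubconvergence.transBasepoint_eq, D₂.embed_basepoint]

/-- **Re-basing** (`Prop` level, general sequences): a pointed `Cᵏ_loc` limit `(𝓤, u)` of
`(𝓢ₙ, pₙ)` is, re-based at any of its points `x`, the limit of a shifted subsequence with moved
base points. [cite: Hale1980, Ch. I §8 Thm. 8.1] -/
theorem SubconvergesLocallyTo.rebase' {𝓢ₙ : ℕ → Spacetime.{u} 4} {pₙ : ∀ n, (𝓢ₙ n).carrier}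
    {u : 𝓤.carrier} (h : SubconvergesLocallyTo 𝓢ₙ pₙ 𝓤 u k) (x : 𝓤.carrier) :
    ∃ (σ : ℕ → ℕ) (Q : ∀ m, (𝓢ₙ (σ m)).carrier), StrictMono σ ∧
      SubconvergesLocallyTo (fun m ↦ 𝓢ₙ (σ m)) Q 𝓤 x k := by
  obtain ⟨D⟩ := h
  exact ⟨fun m ↦ D.sub (m + D.rebaseShift x), D.rebaseBasepoint x,
    D.strictMono_sub_add_rebaseShift x, ⟨D.rebase x⟩⟩

/-- **Re-basing** (`Prop` level): a limit of translates of `𝓢` based at `u` is, re-based at any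
of its points `x`, again a limit of translates of `𝓢`. [cite: Hale1980, Ch. I §8 Thm. 8.1] -/
theorem SubconvergesLocallyTo.rebase {q : ℕ → 𝓢.carrier} {u : 𝓤.carrier}
    (h : SubconvergesLocallyTo (fun _ ↦ 𝓢) q 𝓤 u k) (x : 𝓤.carrier) :
    ∃ Q : ℕ → 𝓢.carrier, SubconvergesLocallyTo (fun _ ↦ 𝓢) Q 𝓤 x k := by
  obtain ⟨D⟩ := h
  exact ⟨D.rebaseBasepoint x, ⟨D.rebase x⟩⟩

/-- **Hulls of hull elements are hull elements** (the set of pointed `Cᵏ_loc` limits of translates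
of `𝓢` is closed under taking limits of translates, at arbitrary base points): if `(𝓣, t)` is a
limit of translates of `𝓢` and `(𝓤, u)` is a limit of translates of `𝓣`, then `(𝓤, x)` is a limit
of translates of `𝓢` for every `x : 𝓤` (`trans` followed by `rebase`). Hale 1980, Ch. I §8,
Thm. 8.1. [cite: Hale1980, Ch. I §8 Thm. 8.1] -/
theorem SubconvergesLocallyTo.trans_rebase {q : ℕ → 𝓢.carrier} {t : 𝓣.carrier}
    {q' : ℕ → 𝓣.carrier} {u : 𝓤.carrier} (h₁ : SubconvergesLocallyTo (fun _ ↦ 𝓢) q 𝓣 t k)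
    (h₂ : SubconvergesLocallyTo (fun _ ↦ 𝓣) q' 𝓤 u k) (x : 𝓤.carrier) :
    ∃ Q : ℕ → 𝓢.carrier, SubconvergesLocallyTo (fun _ ↦ 𝓢) Q 𝓤 x k := by
  obtain ⟨Q, hQ, -⟩ := h₁.trans h₂
  exact hQ.rebase x

end PropLevel

end Spacetime

end Literature.Geometry.Lorentzian
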